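import Mathlib
import HarnessLib
import Literature.Combinatorics.Additive.Pollard
import Literature.Combinatorics.Additive.Kneser
import Literature.Combinatorics.Additive.GrynkiewiczPollardExtension
import Literature.Combinatorics.Additive.GrynkiewiczPollardRep
import Literature.Combinatorics.Additive.GrynkiewiczPollardKneserTools
import Literature.Combinatorics.Additive.GrynkiewiczPollardStepOne
import Literature.Combinatorics.Additive.GrynkiewiczPollardStepTwo
import Literature.Combinatorics.Additive.GrynkiewiczPollardDyson
import Literature.Combinatorics.Additive.GrynkiewiczPollardStepThree
import Literature.Combinatorics.Additive.GrynkiewiczPollardStepThreeT2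
import Literature.Combinatorics.Additive.GrynkiewiczPollardStepFourA
import Literature.Combinatorics.Additive.GrynkiewiczPollardStepFourB

/-!
# Grynkiewicz's extension of Pollard's theorem — port, part X: the induction and Theorems 1.1 / 1.2

Topic: `Literature/Combinatorics/Additive`.  Final file of the port of [Gry10] Theorem 1.1 / 1.2: STEP 4
(the Dyson pair), the induction step (symmetry, the base case `|B| = t`, (stab-A-small), the maximal
translate, STEP 3 / STEP 4), the well-founded induction on the measure
`(N_t, 2N_t − |A| − |B|, min(|A|,|B|))`, the case `t = 1` (Kneser), and the discharge of the named facts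
`grynkiewicz2010_thm_1_1` and `grynkiewicz2010_thm_1_2` of `GrynkiewiczPollardExtension.lean`, as printed
(with (8) as the two filter equalities and (9)/(13) over `ℤ`).

## References
* D. J. Grynkiewicz, *On extending Pollard's theorem for t-representable sums*, Israel J. Math. 177 (2010)
  413–439 (arXiv:0803.2601), Theorem 1.1, Theorem 1.2 and §2 [cite: Grynkiewicz2010, Thm 1.1]
  [cite: Grynkiewicz2010, Thm 1.2].
-/

namespace Literature.Combinatorics.Additive

namespace Grynkiewicz

open Finset Pollard
open scoped Pointwise

variable {G : Type*} [AddCommGroup G] [DecidableEq G]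

section Assembly

variable {t c : ℕ} {A B : Finset G}

/-- Arithmetic for `|H| − ρ ≤ 2t − 2` in STEP 4: the stabilizer bound (9) then gives the Pollard bound with
constant `2t² − 2t`. [cite: Grynkiewicz2010, §2 Step 4] -/
theorem rho_small_arith {t l d S N ab : ℕ} (hlt : l + 1 ≤ t) (hd : d + 2 ≤ 2 * t)
    (hS : S + d + l = ab) (hN : t * S + l * d ≤ N) : t * ab + 2 * t ≤ N + 2 * t * t := by
  obtain ⟨q, rfl⟩ : ∃ q, t = l + q + 1 := ⟨t - l - 1, by omega⟩
  obtain ⟨r, hr⟩ : ∃ r, 2 * l + 2 * q = d + r := ⟨2 * l + 2 * q - d, by omega⟩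
  subst hS
  have h1 : (q + 1) * (d + r) = (q + 1) * (2 * l + 2 * q) := by rw [hr]
  have h2 : l ≤ l * (l + q) := by
    rcases Nat.eq_zero_or_pos l with h | h
    · simp [h]
    · exact Nat.le_mul_of_pos_right l (by omega)
  nlinarith [h1, h2]

/-- **STEP 4 of [Gry10] §2** (with the translate already applied to `B`): if `I = A ∩ B` has
`t ≤ |I| < |B|` and every translate of `B` is inside `A` or meets it in at most `|I|` points, then
`Goal t c A B` — apply the induction hypothesis to `(A ∪ B, A ∩ B)`, then STEP 1 and Cases 4.1 / 4.2.
[cite: Grynkiewicz2010, §2 Step 4] -/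
theorem step_four (ht : 2 ≤ t) (hc : t * t ≤ c) (hc3 : 2 * t * t ≤ c + 2 * t) (ih : IH t c A B)
    (hBA : B.card ≤ A.card) (hB : t + 1 ≤ B.card) (hIt : t ≤ (A ∩ B).card) (hIB : (A ∩ B).card < B.card)
    (hmax : ∀ z : G, (A ∩ (z +ᵥ B)).card ≤ (A ∩ B).card ∨ z +ᵥ B ⊆ A) : Goal t c A B := by
  have hA : t + 1 ≤ A.card := hB.trans hBA
  by_cases hP : t * (A.card + B.card) ≤ NS t A B + c
  · exact Or.inl hP
  rw [not_le] at hP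
  set U := A ∪ B with hU
  set I := A ∩ B with hI
  have hcardUI : U.card + I.card = A.card + B.card := card_union_add_card_inter A B
  have hNSUI : NS t U I ≤ NS t A B := NS_union_inter_le t A B
  have hIU : I.card ≤ U.card := card_le_card (inter_subset_left.trans subset_union_left)
  have hUt : t ≤ U.card := by omega
  have hmeas : meas t U I < meas t A B := by
    rcases hNSUI.lt_or_eq with h | h
    · exact meas_lt_of_NS_lt h
    · refine meas_lt_of_min_lt h hcardUI ?_
      rw [min_eq_right hIU, min_eq_right hBA]; exact hIB
  rcases ih U I hmeas hUt hIt with hPUI | ⟨U', I', hS⟩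
  · left; rw [← hcardUI]; omega
  obtain ⟨hU'ne, hI'ne⟩ := hS.nonempty hUt hIt
  obtain ⟨U'', I'', hS2, hsum, hsubU, hsubI, hsU, hsI⟩ := hS.saturate hU'ne hI'ne
  rw [← hsum] at hsU hsI
  have hU''ne : U''.Nonempty := hU'ne.mono hsubU
  have hI''ne : I''.Nonempty := hI'ne.mono hsubI
  rcases step_one hS2 hU''ne hI''ne hsU hsI with h1 | ⟨htight, hHρ, h9⟩
  · left; rw [← hcardUI]; omega
  set H := (U'' + I'').addStab with hH
  set l := (U \ U'').card + (I \ I'').card with hl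
  set ρ := ((U'' + H).card - U''.card) + ((I'' + H).card - I''.card) with hρ
  have hSne : (U'' + I'').Nonempty := hU''ne.add hI''ne
  have hρU : U''.card ≤ (U'' + H).card := card_le_card_add_addStab hSne U''
  have hρI : I''.card ≤ (I'' + H).card := card_le_card_add_addStab hSne I''
  have hcU := card_sdiff_add_card_eq_card hS2.1
  have hcI := card_sdiff_add_card_eq_card hS2.2.1
  have hlt : l + 1 ≤ t := hS2.2.2.1
  -- `|H| ≥ ρ + 2t − 1`, else the stabilizer bound already gives the Pollard bound
  by_cases hHρ2 : ρ + 2 * t ≤ H.card + 1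
  swap
  · left
    obtain ⟨d, hd⟩ : ∃ d, H.card = ρ + d := ⟨H.card - ρ, by omega⟩
    rw [hd, Nat.add_sub_cancel_left] at h9
    have hSd : (U'' + I'').card + d + l = A.card + B.card := by omega
    have := rho_small_arith hlt (by omega) hSd (h9.trans hNSUI)
    rw [← hcardUI] at this ⊢; omega
  by_cases hl0 : l = 0
  · -- Case 4.2: no deletions, `U'' = U`, `I'' = I`
    have hUeq : U'' = U := eq_of_subset_of_card_le hS2.1 (by omega)
    have hIeq : I'' = I := eq_of_subset_of_card_le hS2.2.1 (by omega)
    have hpop := hS2.2.2.2.1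
    subst hUeq; subst hIeq
    exact case42 ht hc ih hBA hB hIt hIB hmax hpop htight hHρ2 hP
  · have hl1 : 1 ≤ ((A ∪ B) \ U'').card + ((A ∩ B) \ I'').card := by rw [← hU, ← hI]; omega
    exact case41 ht hc hc3 ih hA hB hS2 hU''ne hI''ne hsU hsI htight hHρ2 hP hl1

/-- The induction hypothesis is invariant under translating `B`. [cite: Grynkiewicz2010, §2 Step 4] -/
theorem IH.vadd (h : IH t c A B) (x : G) : IH t c A (x +ᵥ B) := by
  intro A₁ B₁ hlt h1 h2
  refine h A₁ B₁ ?_ h1 h2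
  have : meas t A (x +ᵥ B) = meas t A B := by
    unfold meas; rw [NS_vadd_right, card_vadd_finset]
  rwa [this] at hlt

/-- **The induction step of [Gry10] §2**, for `|B| ≤ |A|`. [cite: Grynkiewicz2010, Thm 1.1] -/
theorem step_of_le (ht : 2 ≤ t) (hc : t * t ≤ c) (hc3 : 2 * t * t ≤ c + 2 * t)
    (hct : t = 2 ∨ 2 * t * t ≤ c + 1) (ih : IH t c A B) (hA : t ≤ A.card) (hB : t ≤ B.card)
    (hBA : B.card ≤ A.card) : Goal t c A B := by
  -- base case `|B| = t`
  by_cases hBt : B.card ≤ t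
  · left
    rw [NS_eq_card_mul_card A hBt]
    have : B.card = t := le_antisymm hBt hB
    rw [this]; nlinarith
  have hB1 : t + 1 ≤ B.card := by omega
  have hA1 : t + 1 ≤ A.card := by omega
  have hAne : A.Nonempty := card_pos.1 (by omega)
  have hBne : B.Nonempty := card_pos.1 (by omega)
  -- (stab-A-small)
  by_cases hstab : t ≤ A.addStab.card
  · exact goal_of_card_addStab_ge (by omega) hc ih hA1 hB1 hstab
  rw [not_le] at hstab
  -- the maximal translate
  obtain ⟨x, hx1, hx2, hmax⟩ := exists_max_translate hAne hBne (by omega)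
  by_cases hm : t ≤ (A ∩ (x +ᵥ B)).card
  · -- STEP 4 for `(A, x + B)`
    refine Goal.of_vadd_right (x := x) (step_four ht hc hc3 (ih.vadd x) (by rw [card_vadd_finset]; exact hBA)
      (by rw [card_vadd_finset]; exact hB1) hm (by rw [card_vadd_finset]; exact hx2) fun z => ?_)
    rw [vadd_vadd]
    exact hmax (z + x)
  · -- STEP 3
    rw [not_le] at hm
    by_cases ht2 : t = 2
    · subst ht2
      exact step_three_t2 (by omega) ih hBA (by omega) fun z => (hmax z).imp (fun h => by omega) id
    · have hc2 : 2 * t * t ≤ c + 1 := hct.resolve_left ht2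
      have ht3 : 3 ≤ t := by omega
      exact step_three_ge3 ht3 hc hc2 ih hBA hB1 fun z => (hmax z).imp (fun h => by omega) id

/-- **The induction step of [Gry10] §2.** [cite: Grynkiewicz2010, Thm 1.1] -/
theorem step (ht : 2 ≤ t) (hc : t * t ≤ c) (hc3 : 2 * t * t ≤ c + 2 * t)
    (hct : t = 2 ∨ 2 * t * t ≤ c + 1) (ih : IH t c A B) (hA : t ≤ A.card) (hB : t ≤ B.card) :
    Goal t c A B := by
  rcases le_total B.card A.card with hBA | hAB
  · exact step_of_le ht hc hc3 hct ih hA hB hBA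
  · exact (step_of_le ht hc hc3 hct ih.symm hB hA hAB).symm

/-- **[Gry10] Theorem 1.1 / 1.2 in dichotomy form:** for `t ≥ 2` and an admissible constant `c`
(`c = 2t² − 1`, or `c = 4` when `t = 2`), every pair with `|A|, |B| ≥ t` satisfies the Pollard-type
bound `t(|A| + |B|) ≤ N_t(A,B) + c` or the structural alternative `Str`. [cite: Grynkiewicz2010, Thm 1.1] -/
theorem goal_all (ht : 2 ≤ t) (hc : t * t ≤ c) (hc3 : 2 * t * t ≤ c + 2 * t)
    (hct : t = 2 ∨ 2 * t * t ≤ c + 1) (A B : Finset G) (hA : t ≤ A.card) (hB : t ≤ B.card) :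
    Goal t c A B := by
  generalize hμ : meas t A B = μ
  induction μ using WellFoundedLT.induction generalizing A B with
  | _ μ IHμ =>
    subst hμ
    exact step ht hc hc3 hct (fun A₁ B₁ hlt h1 h2 => IHμ _ hlt A₁ B₁ h1 h2 rfl) hA hB

/-! ### The printed statements -/

/-- From the structural alternative to the printed clauses (7), (8), `H` nontrivial, (9) of
[Gry10] Thm 1.1 (with `2c' ≥ …` irrelevant): the common final bookkeeping for Theorems 1.1 and 1.2.
[cite: Grynkiewicz2010, Thm 1.1] -/
theorem printed_of_str (ht : 1 ≤ t) (hA : t ≤ A.card) (hB : t ≤ B.card) {A' B' : Finset G}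
    (hS : Str t A B A' B') :
    t * A.card + t * B.card ≤ NS t A B + t * t ∨
    ∃ A'' ⊆ A, ∃ B'' ⊆ B,
      (A \ A'').card + (B \ B'').card + 1 ≤ t ∧
      (A'' + B'').filter (fun x => t ≤ rep A'' B'' x) = A'' + B'' ∧
      A'' + B'' = (A + B).filter (fun x => t ≤ rep A B x) ∧
      1 < ((A + B).filter (fun x => t ≤ rep A B x)).addStab.card ∧
      (t : ℤ) * A.card + t * B.card -
          (t - ((A \ A'').card + (B \ B'').card : ℕ)) *
            ((((A + B).filter (fun x => t ≤ rep A B x)).addStab.card : ℤ) -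
              (((A'' + ((A + B).filter (fun x => t ≤ rep A B x)).addStab).card - A''.card) +
                ((B'' + ((A + B).filter (fun x => t ≤ rep A B x)).addStab).card - B''.card) : ℕ)) -
          t * ((A \ A'').card + (B \ B'').card : ℕ) ≤ (NS t A B : ℤ) ∧
      (t : ℤ) * A.card + t * B.card - t * ((A + B).filter (fun x => t ≤ rep A B x)).addStab.card ≤
        (t : ℤ) * A.card + t * B.card -
          (t - ((A \ A'').card + (B \ B'').card : ℕ)) *
            ((((A + B).filter (fun x => t ≤ rep A B x)).addStab.card : ℤ) -
              (((A'' + ((A + B).filter (fun x => t ≤ rep A B x)).addStab).card - A''.card) +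
                ((B'' + ((A + B).filter (fun x => t ≤ rep A B x)).addStab).card - B''.card) : ℕ)) -
          t * ((A \ A'').card + (B \ B'').card : ℕ) := by
  obtain ⟨hA'ne, hB'ne⟩ := hS.nonempty hA hB
  obtain ⟨A'', B'', hS2, hsum, hsubA, hsubB, hsA, hsB⟩ := hS.saturate hA'ne hB'ne
  rw [← hsum] at hsA hsB
  have hA''ne : A''.Nonempty := hA'ne.mono hsubA
  have hB''ne : B''.Nonempty := hB'ne.mono hsubB
  rcases step_one hS2 hA''ne hB''ne hsA hsB with h1 | ⟨htight, hHρ, h9⟩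
  · left; rw [mul_add] at h1; exact h1
  right
  have hfilt : A'' + B'' = (A + B).filter (fun x => t ≤ rep A B x) := by
    ext w
    rw [mem_filter]
    exact ⟨fun hw => ⟨hS2.add_subset hw, (hS2.le_rep_iff w).2 hw⟩, fun hw => (hS2.le_rep_iff w).1 hw.2⟩
  refine ⟨A'', hS2.1, B'', hS2.2.1, hS2.2.2.1, filter_true_of_mem hS2.2.2.2.1, hfilt, ?_⟩
  rw [← hfilt]
  set H := (A'' + B'').addStab with hH
  set l := (A \ A'').card + (B \ B'').card with hl
  have hSne : (A'' + B'').Nonempty := hA''ne.add hB''ne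
  have hρA : A''.card ≤ (A'' + H).card := card_le_card_add_addStab hSne A''
  have hρB : B''.card ≤ (B'' + H).card := card_le_card_add_addStab hSne B''
  set ρ := ((A'' + H).card - A''.card) + ((B'' + H).card - B''.card) with hρ
  have hcA := card_sdiff_add_card_eq_card hS2.1
  have hcB := card_sdiff_add_card_eq_card hS2.2.1
  have hlt : l + 1 ≤ t := hS2.2.2.1
  obtain ⟨d, hd⟩ : ∃ d, H.card = ρ + d := ⟨H.card - ρ, by omega⟩
  rw [hd, Nat.add_sub_cancel_left] at h9
  have hSd : (A'' + B'').card + d + l = A.card + B.card := by omega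
  refine ⟨by omega, ?_, ?_⟩
  · -- (9), first inequality
    have e1 : ((t - l : ℕ) : ℤ) = (t : ℤ) - l := by push_cast [show l ≤ t by omega]; ring
    have key : (t : ℤ) * A.card + t * B.card - (t - l) * (d : ℤ) - t * l ≤ (NS t A B : ℤ) := by
      have h9' : ((t * (A'' + B'').card + l * d : ℕ) : ℤ) ≤ (NS t A B : ℤ) := by exact_mod_cast h9
      have hSd' : (((A'' + B'').card + d + l : ℕ) : ℤ) = ((A.card + B.card : ℕ) : ℤ) := by
        exact_mod_cast hSd
      push_cast at h9' hSd'
      nlinarith [h9', hSd']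
    have e2 : ((ρ + d : ℕ) : ℤ) - (ρ : ℤ) = d := by push_cast; ring
    rw [hd]
    rw [e2]
    convert key using 2
  · -- (9), second inequality
    rw [hd]
    have e2 : ((ρ + d : ℕ) : ℤ) - (ρ : ℤ) = d := by push_cast; ring
    rw [e2]
    have hdt : (t : ℤ) + 1 ≤ d := by exact_mod_cast (show t + 1 ≤ d by omega)
    have hl0 : (0 : ℤ) ≤ l := by exact_mod_cast Nat.zero_le l
    have hlt' : (l : ℤ) ≤ t := by exact_mod_cast (show l ≤ t by omega)
    have hρ0 : (0 : ℤ) ≤ ρ := by exact_mod_cast Nat.zero_le ρ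
    push_cast [show l ≤ t by omega]
    nlinarith [mul_nonneg hl0 (sub_nonneg.2 hdt), hρ0, hlt']

/-- The case `t = 1` of [Gry10] Thm 1.1 is Kneser's theorem. [cite: Grynkiewicz2010, Thm 1.1] -/
theorem printed_t1 (hA : A.Nonempty) (hB : B.Nonempty) :
    1 * A.card + 1 * B.card + 1 ≤ NS 1 A B + 2 * 1 ^ 2 ∨
    ∃ A'' ⊆ A, ∃ B'' ⊆ B,
      (A \ A'').card + (B \ B'').card + 1 ≤ 1 ∧
      (A'' + B'').filter (fun x => 1 ≤ rep A'' B'' x) = A'' + B'' ∧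
      A'' + B'' = (A + B).filter (fun x => 1 ≤ rep A B x) ∧
      1 < ((A + B).filter (fun x => 1 ≤ rep A B x)).addStab.card ∧
      (1 : ℤ) * A.card + 1 * B.card -
          (1 - ((A \ A'').card + (B \ B'').card : ℕ)) *
            ((((A + B).filter (fun x => 1 ≤ rep A B x)).addStab.card : ℤ) -
              (((A'' + ((A + B).filter (fun x => 1 ≤ rep A B x)).addStab).card - A''.card) +
                ((B'' + ((A + B).filter (fun x => 1 ≤ rep A B x)).addStab).card - B''.card) : ℕ)) -
          1 * ((A \ A'').card + (B \ B'').card : ℕ) ≤ (NS 1 A B : ℤ) ∧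
      (1 : ℤ) * A.card + 1 * B.card - 1 * ((A + B).filter (fun x => 1 ≤ rep A B x)).addStab.card ≤
        (1 : ℤ) * A.card + 1 * B.card -
          (1 - ((A \ A'').card + (B \ B'').card : ℕ)) *
            ((((A + B).filter (fun x => 1 ≤ rep A B x)).addStab.card : ℤ) -
              (((A'' + ((A + B).filter (fun x => 1 ≤ rep A B x)).addStab).card - A''.card) +
                ((B'' + ((A + B).filter (fun x => 1 ≤ rep A B x)).addStab).card - B''.card) : ℕ)) -
          1 * ((A \ A'').card + (B \ B'').card : ℕ) := by
  have hNS : NS 1 A B = (A + B).card := by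
    rw [NS_eq_mul_card_add_of_popular (fun w hw => one_le_rep_of_mem hw), one_mul]
  have hfilt : (A + B).filter (fun x => 1 ≤ rep A B x) = A + B :=
    filter_true_of_mem fun w hw => one_le_rep_of_mem hw
  by_cases hk : A.card + B.card ≤ (A + B).card + 1
  · left; rw [hNS]; omega
  right
  rw [not_le] at hk
  have hSne : (A + B).Nonempty := hA.add hB
  have htight := kneser_eq_of_card_add_lt hA hB (by omega)
  have hH := one_lt_card_addStab_of_card_add_le hA hB (by omega)
  refine ⟨A, Subset.refl _, B, Subset.refl _, by simp, filter_true_of_mem fun w hw => one_le_rep_of_mem hw,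
    hfilt.symm, by rw [hfilt]; exact hH, ?_, ?_⟩
  · rw [hfilt, hNS]
    have hρA : A.card ≤ (A + (A + B).addStab).card := card_le_card_add_addStab hSne A
    have hρB : B.card ≤ (B + (A + B).addStab).card := card_le_card_add_addStab hSne B
    have h0 : (A \ A).card + (B \ B).card = 0 := by simp
    rw [h0]
    push_cast [hρA, hρB]
    have ht' : (((A + B).card + (A + B).addStab.card : ℕ) : ℤ) =
        (((A + (A + B).addStab).card + (B + (A + B).addStab).card : ℕ) : ℤ) := by exact_mod_cast htight
    push_cast at ht'
    linarith
  · rw [hfilt]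
    have h0 : (A \ A).card + (B \ B).card = 0 := by simp
    rw [h0]
    have hρ0 : (0 : ℤ) ≤ (((A + (A + B).addStab).card - A.card) + ((B + (A + B).addStab).card - B.card) : ℕ) := by
      exact_mod_cast Nat.zero_le _
    simp only [Nat.cast_zero, sub_zero, one_mul]
    linarith

end Assembly

end Grynkiewicz

/-! ### Discharge of the named facts -/

open Finset Grynkiewicz in
/-- **[Gry10] Theorem 1.1 holds** (the named fact `grynkiewicz2010_thm_1_1`, as printed): proved by the
triple induction of [Gry10] §2 over Kneser's theorem (`Literature.Combinatorics.Additive.add_kneser`).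
[cite: Grynkiewicz2010, Thm 1.1] -/
theorem grynkiewicz2010_thm_1_1_holds : grynkiewicz2010_thm_1_1 := by
  intro G _ _ A B t ht hAne hBne hA hB
  by_cases ht1 : t = 1
  · subst ht1
    exact printed_t1 hAne hBne
  have ht2 : 2 ≤ t := by omega
  obtain ⟨T2, hT2⟩ : ∃ T2, T2 = 2 * t * t := ⟨_, rfl⟩
  have hT2a : t * t + 1 ≤ T2 := by rw [hT2]; nlinarith
  have hgoal := goal_all (c := T2 - 1) ht2 (by omega) (by rw [← hT2]; omega)
    (Or.inr (by rw [← hT2]; omega)) A B hA hB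
  have e2 : 2 * t ^ 2 = T2 := by rw [hT2]; ring
  rcases hgoal with hP | ⟨A', B', hS⟩
  · left
    change t * A.card + t * B.card + 1 ≤ NS t A B + 2 * t ^ 2
    rw [e2]
    rw [mul_add] at hP
    omega
  · rcases printed_of_str (by omega) hA hB hS with hP | hrest
    · left
      change t * A.card + t * B.card + 1 ≤ NS t A B + 2 * t ^ 2
      rw [e2]
      omega
    · right; exact hrest

open Finset Grynkiewicz in
/-- **[Gry10] Theorem 1.2 holds** (the named fact `grynkiewicz2010_thm_1_2`, as printed; `t = 2` with the
sharp constant `4`). [cite: Grynkiewicz2010, Thm 1.2] -/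
theorem grynkiewicz2010_thm_1_2_holds : grynkiewicz2010_thm_1_2 := by
  intro G _ _ A B hAne hBne hA hB
  have hgoal := goal_all (t := 2) (c := 4) le_rfl (by norm_num) (by norm_num) (Or.inl rfl) A B hA hB
  rcases hgoal with hP | ⟨A', B', hS⟩
  · left
    change 2 * A.card + 2 * B.card ≤ NS 2 A B + 4
    rw [mul_add] at hP; exact hP
  · rcases printed_of_str (by norm_num) hA hB hS with hP | ⟨A'', hA'', B'', hB'', h7, h8a, h8b, hH, h9a, h9b⟩
    · left
      change 2 * A.card + 2 * B.card ≤ NS 2 A B + 4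
      omega
    · right
      exact ⟨A'', hA'', B'', hB'', by omega, h8a, h8b, hH, h9a, h9b⟩

end Literature.Combinatorics.Additive
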